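import Summits.HodgeConjecture.HodgeConjecture.Theorems.Ring2AbelianAllAndreSmoothFamilyPrimitiveParts
import HarnessLib

/-!
# Ring 2 · sub-cell AbelianAll (ALL ABELIAN VARIETIES), André axis, part XII-d — the named fact
# `Deligne1971_fibreGysin_injOn_restricted` ("`Ker j_{t*} ∩ Im j_t^* = 0`" for every smooth projective family
# over a smooth projective base) PROVED from the named fact `deligne1968_invariantClass_fromTotalSpace`
# (Voisin II Thm. 4.18)

HONEST FRAMING (page 1, verbatim): **research route, not a corollary; conditional on HC_CM plus one named
minimal statement.** Cell line: research route conditional on HC_CM; not a corollary; Q11.4-sentence-2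
already refuted in dim ≥ 3. Nothing in this file proves a case of the Hodge conjecture. Seat
`pub-hodge-ring2-ab-andre-2`, gen 4; item o12 of RING2-MAP §AbelianAll AA2.30.

## What is proved

**`deligne1971_fibreGysin_injOn_restricted_of_deligne1968 :
  deligne1968_invariantClass_fromTotalSpace → Deligne1971_fibreGysin_injOn_restricted`.**

The two named facts of the tree involved: the HYPOTHESIS `h418` (`HodgeTheory/InvariantClassesFromTotalSpace`;
Deligne 1968 Prop. 2.1 + (2.6.3), Voisin II Thm. 4.18 verbatim: "for every `k`, the restriction map
`Hᵏ(X, ℚ) → Hᵏ(X_y, ℚ)^{inv}` is surjective", on the étalé carriers `FiberClass f k`) and the CONCLUSION, the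
lit seat's `Deligne1971_fibreGysin_injOn_restricted` (`HodgeTheory/SmoothFamilyFibreClasses`, a
"print-assembled corollary of Deligne 4.1.1 + 4.2.6 with no single verbatim locator"): for every smooth
projective family `f : 𝒳 ⟶ S` of relative dimension `n` over a smooth projective base `S` of dimension `m` with
`𝒳` smooth projective of dimension `N`, all degrees `k + 2N = b + 2n`, every `t` and every global `W`:
`j_{t*}(j_t^* W) = 0 ⟹ j_t^* W = 0`. So after this part the cell's κ̂ is a THEOREM MODULO `h418` (and κ,
`FibreGysinKernelCompactPencils`, a theorem modulo `h418` in two ways: part XII-b directly, or lit's one-line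
wrapper through κ̂).

The argument is that of parts XII-a/XII-b (de Cataldo 2007, Ex. 8.5.2–8.5.3 / Prop. 8.5.5 (b), made honest on
the carriers), run for a base of dimension `m`: `N = n + m` (part XII-c §1); `j_{t*}` is injective on
`H^{2n}(X_t)` (XII-c §2), so `j_{t*} a = 0` forces `j_t^* y ∪ a = 0` for all global `y` (projection formula);
`Im j_t^*` is stable under the primitive projections of a global Kähler class (XII-c §4, from `h418`), so the
polarisation form of the Kähler–rational datum of `X_t` vanishes on `Im j_t^* × {a}` (the cup-product bridge
of XII-a §1); `im j^*_ℚ` underlies a sub-Hodge structure of the POLARISED `ℚ`-Hodge structure `Hᵏ(X_t(ℂ); ℚ)`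
(tree: `hodgeStructureHom`, `Hom.exists_subHodgeStructure_range`, `KaehlerRationalDatum.polarization`), on
which the polarisation is non-degenerate (`Polarization.eq_zero_of_forall_mem_baseChange`): `a = 0`. Degree
`k = 0` (all `n`) is elementary (`H⁰ = ℂ · 1`, `[X_t] ≠ 0`); `n = 0` reduces to it.

References: VoisinHodgeII2003 (Thm. 4.15, Lemma 4.17, Thm. 4.18, Thm. 4.24); Deligne1968 ((2.1), (2.6.3));
DeligneHodgeII1971 (4.1.1, 4.2.6); Decataldo2007 (Ex. 8.5.2–8.5.3, Prop. 8.5.5); VoisinHodgeI2002 (Thm. 6.32,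
§7.1.2, Lemma 7.26, §7.3.1–7.3.2); Voisin2025 (Prop. 2.11); FultonYoungTableaux1997 (App. B (6)).
-/

noncomputable section

set_option linter.dupNamespace false

namespace Summit.HodgeConjecture.HodgeConjecture.Ring2.AbelianAll

open CategoryTheory AlgebraicGeometry MonoidalCategory
open scoped TensorProduct
open Literature.AlgebraicGeometry Literature.AlgebraicGeometry.Motives
open Literature.AlgebraicGeometry.HodgeTheory
open Literature.AlgebraicTopology.SingularHomology (singularCohomology cupProduct cupProduct_map)
open Literature.Geometry.Kaehler (lefschetzOperator HasHardLefschetzProperty)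
open Summit.HodgeConjecture.HodgeConjecture

variable {n m : ℕ} {𝒳 S : SchemeOver ℂ} {f : 𝒳 ⟶ S}

/-! ## §1 The link, general family -/

/-- **`j_t^* y ∪ a = 0` in `H^{2n}(X_t)` whenever `j_{t*} a = 0`** (projection formula `j_{t*}(j_t^* y ∪ a) = y ∪ j_{t*} a`
and injectivity of `j_{t*}` on the top degree, part XII-c). [cite: FultonYoungTableaux1997, Appendix B §B.1 (6)]
[cite: HatcherAT2002, §3.3 Prop. 3.38] -/
theorem cupProduct_map_fiberι_eq_zero_of_complexGysin_eq_zero (hS : IsSmoothProjective m S)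
    (hf : IsSmoothProjectiveFamily f n) (h𝒳 : IsSmoothProjective (n + m) 𝒳) (t : ComplexPoints S)
    {k q b : ℕ} (hq : q + k = 2 * n) (hkb : k + 2 * (n + m) = b + 2 * n) (y : complexBetti 𝒳 q)
    {a : complexBetti (fiberOver f t) k}
    (ha : complexGysin complexOrientationFamily (hf.isSmoothProjective t) h𝒳 (fiberι f t) hkb a = 0) :
    cupProduct hq (complexBetti.map (fiberι f t) q y) a = 0 := by
  have h := complexGysin_cup (μ := complexOrientationFamily) hasPoincareDuality_complexOrientationFamily
    (hf.isSmoothProjective t) h𝒳 (fiberι f t) hq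
    (show 2 * n + 2 * (n + m) = 2 * (n + m) + 2 * n by ring) hkb (show q + b = 2 * (n + m) by omega) y a
  rw [ha, map_zero] at h
  exact complexGysin_fiberι_top_injective hS hf h𝒳 t h

/-- **THE LINK, general family**: for a global `K` with hard Lefschetz on every fibre restricting on `X_t` to the
Kähler class of the Kähler–rational datum `D`, and `a = j_t^* W` with `j_{t*} a = 0`, the polarisation form of `D`
vanishes against the whole image of restriction: `Q_D(j_t^* W', a) = 0` — granted `h418`.
[cite: Decataldo2007, Ex. 8.5.2–8.5.3 and Prop. 8.5.5] [cite: VoisinHodgeI2002, §6.3.2 Thm. 6.32 and Lemma 6.29]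
[cite: VoisinHodgeII2003, §4.3.1 Thm. 4.18] -/
theorem cform_map_fiberι_eq_zero_of_complexGysin_eq_zero (h418 : deligne1968_invariantClass_fromTotalSpace)
    (hS : IsSmoothProjective m S) (hf : IsSmoothProjectiveFamily f n) (h𝒳 : IsSmoothProjective (n + m) 𝒳)
    (t : ComplexPoints S) {K : complexBetti 𝒳 2}
    (hK : ∀ s : ComplexPoints S, HasHardLefschetzProperty (complexBetti.map (fiberι f s) 2 K) n)
    (D : KaehlerRationalDatum n (fiberOver f t)) (hKD : complexBetti.map (fiberι f t) 2 K = D.Hη)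
    {k b : ℕ} (hkb : k + 2 * (n + m) = b + 2 * n) {W : complexBetti 𝒳 k}
    (hW : complexGysin complexOrientationFamily (hf.isSmoothProjective t) h𝒳 (fiberι f t) hkb
      (complexBetti.map (fiberι f t) k W) = 0) (W' : complexBetti 𝒳 k) :
    D.cform (hf.isSmoothProjective t) k (complexBetti.map (fiberι f t) k W')
      (complexBetti.map (fiberι f t) k W) = 0 := by
  classical
  set hXt := hf.isSmoothProjective t
  rw [KaehlerRationalDatum.cform, polarizationForm_apply]
  refine Finset.sum_eq_zero fun P _ ↦ ?_
  rcases le_or_gt (P.1.1 + P.1.2) n with hP | hP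
  · have hP2 := P.2
    obtain ⟨s, hs⟩ : ∃ s, P.1.1 + s = n := ⟨n - P.1.1, by omega⟩
    obtain ⟨s', hs'⟩ : ∃ s', P.1.1 + P.1.2 + s' = n := ⟨n - (P.1.1 + P.1.2), by omega⟩
    rw [hodgeRiemannPairing_apply _ hs rfl (by omega : (P.1.1 + 2 * s) + P.1.1 = 2 * n),
      cupProduct_lefschetzPowTo_primitivePart_eq D.Hη (D.hLℂ hXt) (subsingleton_of_lt hXt ℂ) P
        (primitivePart_mem _ _ P _) _ hs rfl _ hs' rfl (by omega : (P.1.1 + 2 * s') + k = 2 * n)]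
    obtain ⟨B, hB⟩ := exists_primitivePart_map_fiberι_eq_family h418 hS hf h𝒳 K hK W' P t
    rw [primitivePart_congr hKD (hK t) (D.hLℂ hXt) (hvan_fibre hf t) P] at hB
    rw [hB, ← hKD, ← map_fiberι_lefschetzPowTo t K s' P.1.1 (P.1.1 + 2 * s') rfl B,
      cupProduct_map_fiberι_eq_zero_of_complexGysin_eq_zero hS hf h𝒳 t (by omega) hkb _ hW, map_zero, mul_zero]
  · rw [primitivePart_of_lt _ _ P hP, LinearMap.zero_apply, LinearMap.zero_apply, LinearMap.map_zero₂]

/-! ## §2 Degree zero; then the kernel identity in general -/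

/-- **Degree `0`, any family**: for `W ∈ H⁰(𝒳(ℂ); ℂ)`, if `j_{t*} j_t^* W = 0` then `j_t^* W = 0` (`W = c · 1`,
`j_t^* 1 = 1`, `j_{t*}(c · 1) = c · [X_t]`, `[X_t] ≠ 0`). [cite: HatcherAT2002, §3.3 Thm. 3.26 and Prop. 3.10] -/
theorem map_fiberι_eq_zero_of_complexGysin_eq_zero_degZero (hS : IsSmoothProjective m S)
    (hf : IsSmoothProjectiveFamily f n) (h𝒳 : IsSmoothProjective (n + m) 𝒳) (t : ComplexPoints S)
    {b : ℕ} (hkb : 0 + 2 * (n + m) = b + 2 * n) (W : complexBetti 𝒳 0)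
    (hW : complexGysin complexOrientationFamily (hf.isSmoothProjective t) h𝒳 (fiberι f t) hkb
      (complexBetti.map (fiberι f t) 0 W) = 0) :
    complexBetti.map (fiberι f t) 0 W = 0 := by
  obtain rfl : b = 2 * m := by omega
  obtain ⟨c, hc⟩ := exists_eq_smul_one complexOrientationFamily h𝒳 W
  have h1 : complexBetti.map (fiberι f t) 0 W = c • singularCohomology.one ℂ (ComplexPoints (fiberOver f t)) := by
    rw [hc, map_smul]
    exact congrArg (c • ·) (singularCohomology.map_one (R := ℂ) (Motives.AlgPoints.mapContinuous (L := ℂ) (fiberι f t)))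
  rw [h1, map_smul] at hW
  rcases smul_eq_zero.1 hW with hc0 | h0
  · rw [h1, hc0, zero_smul]
  · exact (complexGysin_fiberι_one_ne_zero hS hf h𝒳 t h0).elim

/-- **Deligne's kernel identity at one fibre for an arbitrary smooth projective family over a smooth projective
base, from the named fact `h418`.** For `f : 𝒳 ⟶ S` smooth projective of relative dimension `n`, `S` smooth
projective of dimension `m`, `𝒳` smooth projective of dimension `N`, `k + 2N = b + 2n`, a point `t` and a global
`W ∈ Hᵏ(𝒳(ℂ); ℂ)`: `j_{t*}(j_t^* W) = 0 ⟹ j_t^* W = 0`. (`N = n + m`; `n = 0` or `k = 0`: degree zero; `n ≥ 1`: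
`a = j_t^* W` complexifies an element `m` of `(im j^*_ℚ)_ℂ`, a sub-Hodge structure of the polarised `ℚ`-Hodge
structure `Hᵏ(X_t(ℂ); ℚ)`, pairing to zero with it by §1 — hence `m = 0`.)
[cite: Decataldo2007, Ex. 8.5.2–8.5.3 and Prop. 8.5.5] [cite: Voisin2025, Prop. 2.11]
[cite: VoisinHodgeI2002, Lemma 7.26 and §7.3.2] [cite: VoisinHodgeII2003, §4.3.1 Thm. 4.18] -/
theorem map_fiberι_eq_zero_of_complexGysin_eq_zero_of_deligne1968 (h418 : deligne1968_invariantClass_fromTotalSpace)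
    {N : ℕ} (hS : IsSmoothProjective m S) (hf : IsSmoothProjectiveFamily f n) (h𝒳 : IsSmoothProjective N 𝒳)
    {k b : ℕ} (hkb : k + 2 * N = b + 2 * n) (t : ComplexPoints S) (W : complexBetti 𝒳 k)
    (hW : complexGysin complexOrientationFamily (hf.isSmoothProjective t) h𝒳 (fiberι f t) hkb
      (complexBetti.map (fiberι f t) k W) = 0) :
    complexBetti.map (fiberι f t) k W = 0 := by
  classical
  obtain rfl : N = n + m := dim_total_eq_add hS hf h𝒳
  set hXt := hf.isSmoothProjective t
  -- degree zero / zero-dimensional fibres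
  rcases Nat.eq_zero_or_pos k with rfl | hk
  · exact map_fiberι_eq_zero_of_complexGysin_eq_zero_degZero hS hf h𝒳 t hkb W hW
  rcases Nat.eq_zero_or_pos n with hn0 | hn
  · haveI := subsingleton_complexBetti hXt (show 2 * n < k by omega)
    exact Subsingleton.elim _ _
  -- `n ≥ 1`: the polarisation argument
  obtain ⟨K, D, hKD, hK⟩ := exists_globalKaehlerClass_family hS hf h𝒳 hn t
  obtain ⟨A, hAr⟩ := exists_isReal_hodgeModel_holds n (fiberOver f t) hXt
  obtain ⟨Bm, hBr⟩ := exists_isReal_hodgeModel_holds (n + m) 𝒳 h𝒳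
  have hA := hAr.isHodgeSymmetric
  have hB := hBr.isHodgeSymmetric
  let φ := Bm.hodgeStructureHom h𝒳 hodgePQ_independent_of_hodgeModel_holds hB A hXt hA (fiberι f t) k
  obtain ⟨Ssub, hS'⟩ := φ.exists_subHodgeStructure_range
  let Q := D.polarization hXt A hA k
  obtain ⟨w, hw⟩ := ofRatClassBaseChange_surjective h𝒳 k W
  set mm := φ.toLinearMap.baseChange ℂ w with hmm
  have hm_eq : ofRatClassBaseChange (ComplexPoints (fiberOver f t)) k mm = complexBetti.map (fiberι f t) k W := by
    rw [← hw, hmm, HodgeModel.hodgeStructureHom_toLinearMap]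
    exact HodgeModel.ofRatClassBaseChange_baseChange_map (fiberι f t) k w
  have hm_mem : mm ∈ Ssub.toSubmodule.baseChange ℂ := by
    rw [hS']
    exact baseChange_mem_baseChange_range φ.toLinearMap w
  have h0 : ∀ x ∈ Ssub.toSubmodule.baseChange ℂ, Q.form.baseChange ℂ x mm = 0 := by
    intro x hx
    rw [hS', HodgeModel.hodgeStructureHom_toLinearMap] at hx
    obtain ⟨W', hW'⟩ := exists_map_fiberι_eq_of_mem_baseChange_range t k hx
    change (D.form hXt k).baseChange ℂ x mm = 0
    rw [D.form_baseChange hXt, hm_eq, hW']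
    exact cform_map_fiberι_eq_zero_of_complexGysin_eq_zero h418 hS hf h𝒳 t hK D hKD hkb hW W'
  have hm0 : mm = 0 := Q.eq_zero_of_forall_mem_baseChange Ssub hm_mem h0
  rw [← hm_eq, hm0, map_zero]

/-! ## §3 The named fact `Deligne1971_fibreGysin_injOn_restricted` from `h418`; every fibre -/

/-- **`deligne1968_invariantClass_fromTotalSpace → Deligne1971_fibreGysin_injOn_restricted`**: the lit seat's
named fact "`Ker j_{t*} ∩ Im j_t^* = 0` for every smooth projective family over a smooth projective base"
(print-assembled from Deligne 4.1.1 + 4.2.6) is a CONSEQUENCE of Voisin II Thm. 4.18 (Deligne 1968) and tree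
theorems. [cite: VoisinHodgeII2003, §4.3.1 Thm. 4.18 and §4.3.3 Thm. 4.24] [cite: DeligneHodgeII1971, Thm. 4.1.1 and Thm. 4.2.6]
[cite: Decataldo2007, Ex. 8.5.2–8.5.3 and Prop. 8.5.5] -/
theorem deligne1971_fibreGysin_injOn_restricted_of_deligne1968 (h418 : deligne1968_invariantClass_fromTotalSpace) :
    Deligne1971_fibreGysin_injOn_restricted :=
  fun _ _ _ _ _ _ hS hf h𝒳 _ _ hkb t W hW ↦
    map_fiberι_eq_zero_of_complexGysin_eq_zero_of_deligne1968 h418 hS hf h𝒳 hkb t W hW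

/-- **Every fibre**: granted `h418`, `j_{t*}(j_t^* W) = 0` at ONE point forces `j_s^* W = 0` at EVERY point (lit's
`restrict_eq_zero_of_fibreGysin_eq_zero` fed with the discharged fact; change of fibre = André's flatness (A4),
a tree theorem). [cite: VoisinHodgeII2003, §4.3.1 Thm. 4.18] [cite: Andre1996Motifs, §5.1 (p. 25)] -/
theorem restrict_eq_zero_of_complexGysin_eq_zero_of_deligne1968 (h418 : deligne1968_invariantClass_fromTotalSpace)
    {N : ℕ} (hS : IsSmoothProjective m S) (hf : IsSmoothProjectiveFamily f n) (h𝒳 : IsSmoothProjective N 𝒳)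
    {k b : ℕ} (hkb : k + 2 * N = b + 2 * n) (t s : ComplexPoints S) (W : complexBetti 𝒳 k)
    (hW : complexGysin complexOrientationFamily (hf.isSmoothProjective t) h𝒳 (fiberι f t) hkb
      (complexBetti.map (fiberι f t) k W) = 0) :
    complexBetti.map (fiberι f s) k W = 0 :=
  restrict_eq_zero_of_fibreGysin_eq_zero (deligne1971_fibreGysin_injOn_restricted_of_deligne1968 h418)
    hS hf h𝒳 hkb t s W hW

end Summit.HodgeConjecture.HodgeConjecture.Ring2.AbelianAll

end
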